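import Summits.Ventures.PercRepro.TriangleCapEightB

/-!
# PercRepro — the triangle cap at nullity `8`: `P(8) = 13`, PART C — the counts (p3, gen 22)

The double count `Σ_T |T ∩ V| = Σ_{v ∈ V} t(v)` (`sum_ncard_inter_eq_sum_card_filter`, `sum_degree_eq`), the
three-valued sums (`sum_three_valued`: when every `g T ∈ {0, 1, 3}`, `Σ f (g T) = f 0·#{g = 0} + f 1·#{g = 1} + f 3·#{g = 3}`)
and the pair count (`sum_choose_two_le`: `Σ_T C(|T ∩ Y|, 2) ≤ C(|Y|, 2)` when two triangles never share two points).

Axioms: standard.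
-/

open scoped Matroid

namespace PercRepro

namespace TriangleCap

open Set Finset

open scoped Classical

variable {α : Type}

/-- `|T ∩ V|` as the card of a filter of the finite set `V`. -/
theorem ncard_inter_eq_card_filter {V : Set α} (hV : V.Finite) (T : Set α) :
    (T ∩ V).ncard = (hV.toFinset.filter (fun v => v ∈ T)).card := by
  rw [← Set.ncard_coe_finset]
  congr 1
  ext v
  simp only [Set.mem_inter_iff, Finset.coe_filter, Set.Finite.mem_toFinset, Set.mem_setOf_eq]
  tauto

/-- **The double count** `Σ_{T ∈ 𝒮} |T ∩ V| = Σ_{v ∈ V} #{T ∈ 𝒮 | v ∈ T}`. -/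
theorem sum_ncard_inter_eq_sum_card_filter (𝒮 : Finset (Set α)) {V : Set α} (hV : V.Finite) :
    ∑ T ∈ 𝒮, (T ∩ V).ncard = ∑ v ∈ hV.toFinset, (𝒮.filter (fun T => v ∈ T)).card := by
  have h1 : ∀ T ∈ 𝒮, (T ∩ V).ncard = (hV.toFinset.filter (fun v => v ∈ T)).card :=
    fun T _ => ncard_inter_eq_card_filter hV T
  rw [Finset.sum_congr rfl h1]
  simp only [Finset.card_filter]
  exact Finset.sum_comm

/-- The number of triangles through `v` is the card of the filter of the triangle finset. -/
theorem ncard_trianglesThrough_eq_card_filter (M : Matroid α) (𝒯 : Finset (Set α))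
    (h𝒯 : ∀ T, T ∈ 𝒯 ↔ T ∈ ThmN.triangles M) (v : α) :
    (ThmN.trianglesThrough M v).ncard = (𝒯.filter (fun T => v ∈ T)).card := by
  rw [← Set.ncard_coe_finset]
  congr 1
  ext T
  simp only [ThmN.trianglesThrough, ThmN.triangles, Set.mem_setOf_eq, Finset.coe_filter, h𝒯]
  tauto

/-- The number of triangles is the card of the triangle finset. -/
theorem ncard_triangles_eq_card (M : Matroid α) (𝒯 : Finset (Set α))
    (h𝒯 : ∀ T, T ∈ 𝒯 ↔ T ∈ ThmN.triangles M) : (ThmN.triangles M).ncard = 𝒯.card := by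
  rw [← Set.ncard_coe_finset]
  congr 1
  ext T
  simp only [Finset.mem_coe, h𝒯]

/-- **Degrees against incidences**: `Σ_{v ∈ V} t(v) = Σ_T |T ∩ V|`. -/
theorem sum_degree_eq (M : Matroid α) (𝒯 : Finset (Set α))
    (h𝒯 : ∀ T, T ∈ 𝒯 ↔ T ∈ ThmN.triangles M) {V : Set α} (hV : V.Finite) :
    ∑ v ∈ hV.toFinset, (ThmN.trianglesThrough M v).ncard = ∑ T ∈ 𝒯, (T ∩ V).ncard := by
  rw [sum_ncard_inter_eq_sum_card_filter 𝒯 hV]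
  exact Finset.sum_congr rfl (fun v _ => ncard_trianglesThrough_eq_card_filter M 𝒯 h𝒯 v)

/-- **A three-valued sum**: if every `g T ∈ {0, 1, 3}` then
`Σ_T f (g T) = f 0 · #{g = 0} + f 1 · #{g = 1} + f 3 · #{g = 3}`. -/
theorem sum_three_valued (𝒮 : Finset (Set α)) (g : Set α → ℕ) (f : ℕ → ℕ)
    (hg : ∀ T ∈ 𝒮, g T = 0 ∨ g T = 1 ∨ g T = 3) :
    ∑ T ∈ 𝒮, f (g T) =
      f 0 * (𝒮.filter (fun T => g T = 0)).card + f 1 * (𝒮.filter (fun T => g T = 1)).card +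
        f 3 * (𝒮.filter (fun T => g T = 3)).card := by
  rw [← Finset.sum_filter_add_sum_filter_not 𝒮 (fun T => g T = 3)]
  rw [← Finset.sum_filter_add_sum_filter_not (𝒮.filter (fun T => ¬ g T = 3)) (fun T => g T = 1)]
  have e3 : ∑ T ∈ 𝒮.filter (fun T => g T = 3), f (g T) = (𝒮.filter (fun T => g T = 3)).card * f 3 :=
    Finset.sum_const_nat (fun T hT => by rw [(Finset.mem_filter.1 hT).2])
  have e1 : ∑ T ∈ (𝒮.filter (fun T => ¬ g T = 3)).filter (fun T => g T = 1), f (g T) =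
      (𝒮.filter (fun T => g T = 1)).card * f 1 := by
    rw [Finset.filter_filter]
    have : 𝒮.filter (fun T => ¬ g T = 3 ∧ g T = 1) = 𝒮.filter (fun T => g T = 1) := by
      apply Finset.filter_congr
      intro T _
      constructor
      · exact fun h => h.2
      · intro h; exact ⟨by omega, h⟩
    rw [this]
    exact Finset.sum_const_nat (fun T hT => by rw [(Finset.mem_filter.1 hT).2])
  have e0 : ∑ T ∈ (𝒮.filter (fun T => ¬ g T = 3)).filter (fun T => ¬ g T = 1), f (g T) =
      (𝒮.filter (fun T => g T = 0)).card * f 0 := by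
    rw [Finset.filter_filter]
    have : 𝒮.filter (fun T => ¬ g T = 3 ∧ ¬ g T = 1) = 𝒮.filter (fun T => g T = 0) := by
      apply Finset.filter_congr
      intro T hT
      have := hg T hT
      constructor
      · intro h; omega
      · intro h; omega
    rw [this]
    exact Finset.sum_const_nat (fun T hT => by rw [(Finset.mem_filter.1 hT).2])
  rw [e3, e1, e0]
  ring

/-- **The pair count**: if two distinct members of `𝒮` never share two points of `Y`, then
`Σ_{T ∈ 𝒮} C(|T ∩ Y|, 2) ≤ C(|Y|, 2)`. -/
theorem sum_choose_two_le (𝒮 : Finset (Set α)) {Y : Set α} (hY : Y.Finite)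
    (hpair : ∀ T ∈ 𝒮, ∀ T' ∈ 𝒮, T ≠ T' → ∀ p q, p ≠ q → p ∈ T → p ∈ T' → q ∈ T → q ∈ T' → False) :
    ∑ T ∈ 𝒮, Nat.choose (T ∩ Y).ncard 2 ≤ Nat.choose Y.ncard 2 := by
  let P : Set α → Finset (Finset α) := fun T => (hY.toFinset.filter (fun v => v ∈ T)).powersetCard 2
  have hcard : ∀ T ∈ 𝒮, Nat.choose (T ∩ Y).ncard 2 = (P T).card := by
    intro T _
    rw [ncard_inter_eq_card_filter hY T, Finset.card_powersetCard]
  rw [Finset.sum_congr rfl hcard]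
  have hdisj : (↑𝒮 : Set (Set α)).PairwiseDisjoint P := by
    intro T hT T' hT' hne
    rw [Function.onFun, Finset.disjoint_left]
    intro s hs hs'
    rw [Finset.mem_powersetCard] at hs hs'
    obtain ⟨p, q, hpq, hs2⟩ := Finset.card_eq_two.1 hs.2
    have hp : p ∈ hY.toFinset.filter (fun v => v ∈ T) := hs.1 (by rw [hs2]; simp)
    have hq : q ∈ hY.toFinset.filter (fun v => v ∈ T) := hs.1 (by rw [hs2]; simp)
    have hp' : p ∈ hY.toFinset.filter (fun v => v ∈ T') := hs'.1 (by rw [hs2]; simp)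
    have hq' : q ∈ hY.toFinset.filter (fun v => v ∈ T') := hs'.1 (by rw [hs2]; simp)
    rw [Finset.mem_filter] at hp hq hp' hq'
    exact hpair T (Finset.mem_coe.1 hT) T' (Finset.mem_coe.1 hT') hne p q hpq hp.2 hp'.2 hq.2 hq'.2
  rw [← Finset.card_biUnion hdisj]
  calc (𝒮.biUnion P).card ≤ (hY.toFinset.powersetCard 2).card := by
        apply Finset.card_le_card
        intro s hs
        rw [Finset.mem_biUnion] at hs
        obtain ⟨T, _, hsT⟩ := hs
        rw [Finset.mem_powersetCard] at hsT ⊢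
        exact ⟨hsT.1.trans (Finset.filter_subset _ _), hsT.2⟩
    _ = Nat.choose Y.ncard 2 := by
        rw [Finset.card_powersetCard, Set.ncard_eq_toFinset_card Y hY]

end TriangleCap

end PercRepro
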